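import Summits.HodgeConjecture.HodgeConjecture.Theorems.F0P3cStCharTSPSIrredRegular   -- ★ `exists_eq_smul_of_forall_mem_eq_zero`; brings ★ FILE 1 `RedOfEigenfunctional`, ★ PS-UNITARY, ★ `JacLen1.n1_line_data`
import HarnessLib

/-!
# R90 · S1 — §12.2: a REDUCIBLE unitary principal series `i_G(χ₁, χ₂)` of `U(Φ₃)(L⁺_v)` has SCALAR Jacquet module: `T` acts on `r_B i_G(χ)` by `χ`
# (the converse of ★ B6a «Jacquet semisimple from one vector»; [Casselman1995 §6.3–§6.4, L. 7.1.1; BernsteinZelevinsky1977 §2.3, Thm. 2.9; Keys1984 §3, §7; Rogawski1990 §12.2])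

Cell `hodgecm-mathlib`, SLAB R90-TF, section S1 «Ch. 12 local», crux H413 = `stmt-HodgeConjecture-24833` (lane `--supports … --as helper`), route
HCCMUnconditional; prover seat `hodgecm-mathlib-R90-C10-p05` (g0), S1 WAVE 1 deal «p05 → S1#3 (second hand) ROAD ⇒».  THEOREMS ONLY (no definition ∕
instance ∕ notation ∕ named fact ∕ `sorry`); ★-only imports.

WHAT.  `G = U(Φ₃)(L⁺_v)`, `v` NON-SPLIT, `(B, T, N)` = ★ `cmBorelTriple L 3 v`, `χ = (χ₁, χ₂)` = ★ `cmTorusCharPair L v χ₁ χ₂` continuous with `|χ₁| = 1`,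
`I = i_G(χ)` = ★ `cmPrincipalSeries L 3 v χ`, `r_B I` its normalised Jacquet module (2-dimensional, ★ N1).
* §1 (private helper; generic parabolic triple `t = (P, M, N)` with `δ_P^{1/2}|_N = 1`, any `I` with 2-dimensional `N`-coinvariants) `normalizedJacquet_eq_smul_of_two_eigenfunctionals`:
  two `(P, χ δ_P^{1/2})`-eigenfunctionals `ℓ₁ ≠ 0`, `ℓ₂ ∉ ℂ ℓ₁` on `I` force `r_P(m) = χ(m) · id` on `r_P I` (they descend to `χ`-eigenfunctionals of `r_P I`,
  ★ `exists_coinvFunctional`; both kill `r_P(m) x − χ(m) x`; two functionals on a plane with a common non-zero kernel vector are proportional, ★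
  `exists_eq_smul_of_forall_mem_eq_zero`).
* §2 (CM head) **`normalizedJacquet_cmPrincipalSeries_eq_smul_of_reducible`**: if the unitary `I = i_G(χ₁, χ₂)` has a `G`-stable `⊥ ≠ N ≠ ⊤`, then
  `r_B(m) x = χ(m) x` for EVERY `m ∈ T` and EVERY `x ∈ r_B I` — complete reducibility (★ PS-UNITARY) gives a second eigenfunctional not proportional to
  `ev₁` (★ FILE 1 `exists_eigenfunctional_of_ne_bot_ne_top`), `ev₁` is a non-zero eigenfunctional (★ `toFun_one_apply_borel`, ★ `eq_bot_of_forall_toFun_one_eq_zero`),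
  and §1 applies over the ★ N1 data.  (In particular `wχ = χ` on the closed-cell line — ★ `cmWeylTorusCharPair_eq_of_ne_bot_ne_top` again — and, read
  through ★ D1 `pair_normalizedJacquet_mk_eq_smul_iff_integral_cellFun_eq_zero`, EVERY cell integral `∫_N g₀(m)(w₀ u) du` vanishes: the input of the
  sequel `R90S1KeysChiOneIrreducible`, which evaluates one of them at `χ₁ = 1` and finds it non-zero.)
HONEST LABEL: HC_CM is proved only modulo the 7 printed citations (2 remaining named inputs: hLiu418 = `stmt-HodgeConjecture-24832`, h413 =
`stmt-HodgeConjecture-24833`) until rung 0 closes; count-neutral helper (classical representation theory made available in house).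

## References
* [Casselman1995] W. Casselman, *Introduction to the theory of admissible representations of p-adic reductive groups* (1995), §3.2 Thm. 3.2.4, §6.3, §6.4
  Prop. 6.4.1, Lemma 7.1.1 (a) p. 67.
* [BernsteinZelevinsky1977] I. N. Bernstein, A. V. Zelevinsky, *Induced representations of reductive p-adic groups I*, Ann. Sci. ÉNS 10 (1977), §2.3, Thm. 2.9.
* [Keys1984] D. Keys, *Principal series representations of special unitary groups over local fields*, Compositio Math. 51 (1984), §3, §7.
* [Rogawski1990] J. D. Rogawski, *Automorphic Representations of Unitary Groups in Three Variables*, Ann. of Math. Stud. 123 (1990), §12.1 p. 171, §12.2 pp. 173–174.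
-/

set_option autoImplicit false
-- the mandated namespace has the single-problem summit's repeated segment (`HodgeConjecture.HodgeConjecture`)
set_option linter.dupNamespace false

noncomputable section

open NumberField IsDedekindDomain
open scoped Matrix
open Literature.NumberTheory.Automorphic Literature.NumberTheory.Automorphic.UnitaryGroup
open Summit.HodgeConjecture.HodgeConjecture.Cruxes.H413

namespace Summit.HodgeConjecture.HodgeConjecture.R90.S1

/-! ## §1 Two independent eigenfunctionals make the Jacquet module scalar (generic parabolic triple) -/

section Generic

variable {G : Type*} [Group G] [TopologicalSpace G] [IsTopologicalGroup G] (t : ParabolicTriple G)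

/-- **Two independent `(P, χ δ_P^{1/2})`-eigenfunctionals force `r_P(m) = χ(m)` on a 2-dimensional Jacquet module.**  `t = (P, M, N)` with `δ_P^{1/2}|_N = 1`,
`I` any representation of `G` whose `N`-coinvariants are 2-dimensional, `ℓ₁, ℓ₂` linear functionals with `ℓᵢ (I(p) v) = χ(proj p) δ_P^{1/2}(p) ℓᵢ v`, `ℓ₁ ≠ 0`
and `ℓ₂ ≠ c ℓ₁` for every `c`.  Then `r_P(m) x = χ(m) x` for all `m ∈ M`, `x ∈ r_P I`: the descended functionals (★ `exists_coinvFunctional`) both kill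
`y = r_P(m) x − χ(m) x`; were `y ≠ 0`, both would vanish on the line `ℂ y` and be proportional (★ `exists_eq_smul_of_forall_mem_eq_zero`), hence so would `ℓ₁, ℓ₂`.
[cite: Casselman1995, §6.4 Prop. 6.4.1; §3.2 Thm. 3.2.4] [cite: BernsteinZelevinsky1977, §2.3, Thm. 2.9] -/
private theorem normalizedJacquet_eq_smul_of_two_eigenfunctionals [LocallyCompactSpace ↥t.P]
    (hδ : ∀ (n : G) (hn : n ∈ t.N), rootDeltaChar t.P ⟨n, t.N_le hn⟩ = 1)
    {V : Type*} [AddCommGroup V] [Module ℂ V] (I : Representation ℂ G V) (χ : ↥t.M →* ℂˣ)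
    [FiniteDimensional ℂ (t.restrict I).Coinvariants] (hdim : Module.finrank ℂ (t.restrict I).Coinvariants = 2)
    (ℓ₁ ℓ₂ : V →ₗ[ℂ] ℂ)
    (hℓ₁ : ∀ (p : ↥t.P) (v : V), ℓ₁ (I p v) = ((χ (t.proj p) : ℂˣ) : ℂ) * ((rootDeltaChar t.P p : ℂˣ) : ℂ) * ℓ₁ v)
    (hℓ₂ : ∀ (p : ↥t.P) (v : V), ℓ₂ (I p v) = ((χ (t.proj p) : ℂˣ) : ℂ) * ((rootDeltaChar t.P p : ℂˣ) : ℂ) * ℓ₂ v)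
    (hℓ₁0 : ℓ₁ ≠ 0) (hind : ∀ c : ℂ, ℓ₂ ≠ c • ℓ₁) (m : ↥t.M) (x : (t.restrict I).Coinvariants) :
    I.normalizedJacquet t m x = ((χ m : ℂˣ) : ℂ) • x := by
  obtain ⟨lb₁, hmk₁, heq₁⟩ := F0P2pPrincipalSeriesUniqueSub.exists_coinvFunctional t hδ χ I ℓ₁ hℓ₁
  obtain ⟨lb₂, hmk₂, heq₂⟩ := F0P2pPrincipalSeriesUniqueSub.exists_coinvFunctional t hδ χ I ℓ₂ hℓ₂
  have hlb₁0 : lb₁ ≠ 0 := by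
    intro h0
    apply hℓ₁0
    ext v
    rw [← hmk₁ v, h0, LinearMap.zero_apply, LinearMap.zero_apply]
  have hlbind : ∀ c : ℂ, lb₂ ≠ c • lb₁ := by
    intro c hc
    apply hind c
    ext v
    rw [← hmk₂ v, hc, LinearMap.smul_apply, LinearMap.smul_apply, hmk₁ v]
  -- `y = r(m) x − χ(m) x` is killed by both descended functionals
  set y := I.normalizedJacquet t m x - ((χ m : ℂˣ) : ℂ) • x with hy
  have hy₁ : lb₁ y = 0 := by rw [hy, map_sub, map_smul, heq₁, smul_eq_mul, sub_self]
  have hy₂ : lb₂ y = 0 := by rw [hy, map_sub, map_smul, heq₂, smul_eq_mul, sub_self]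
  by_contra hne
  have hy0 : y ≠ 0 := fun h => hne (sub_eq_zero.1 h)
  -- both vanish on the line `ℂ y`, hence are proportional
  have hlin1 : Module.finrank ℂ ↥(ℂ ∙ y) = 1 := finrank_span_singleton hy0
  have hvan : ∀ lb : (t.restrict I).Coinvariants →ₗ[ℂ] ℂ, lb y = 0 → ∀ z ∈ (ℂ ∙ y), lb z = 0 := by
    intro lb hlb z hz
    obtain ⟨c, rfl⟩ := Submodule.mem_span_singleton.1 hz
    rw [map_smul, hlb, smul_zero]
  obtain ⟨c, hc⟩ := F0P3cStCharTSPSIrredRegular.exists_eq_smul_of_forall_mem_eq_zero hdim (ℂ ∙ y) hlin1 lb₁ lb₂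
    (hvan lb₁ hy₁) (hvan lb₂ hy₂) hlb₁0
  exact hlbind c hc

end Generic

/-! ## §2 The CM head: a reducible unitary `i_G(χ₁, χ₂)` has scalar Jacquet module -/

section CM

variable (L : Type) [Field L] [NumberField L] [IsCMField L] (v : HeightOneSpectrum (𝓞 ↥(maximalRealSubfield L)))
  (hns : ∀ w : PlacesOver L v, IsCMField.complexConj L • w.1 = w.1)

include hns in
set_option synthInstance.maxHeartbeats 400000 in
set_option maxHeartbeats 8000000 in
-- statement∕proof-heavy: the `SmoothInd` carrier of ★ `cmPrincipalSeries`, its Jacquet module from ★ N1 (class of ★ `cmWeylTorusCharPair_eq_of_ne_bot_ne_top`)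
/-- **A REDUCIBLE unitary `i_G(χ₁, χ₂)` has SCALAR Jacquet module** (`v` non-split, `χ₁, χ₂` continuous, `|χ₁| = 1`): if `i_G(χ₁, χ₂)` has a `G`-stable
`⊥ ≠ N ≠ ⊤`, then `r_B(m) x = χ(m) x` for every `m ∈ T` and every `x ∈ r_B i_G(χ₁, χ₂)`.  Complete reducibility (★ PS-UNITARY) and ★ FILE 1
(`exists_eigenfunctional_of_ne_bot_ne_top`) give a `(B, χ δ_B^{1/2})`-eigenfunctional not proportional to the non-zero eigenfunctional `ev₁`; §1 over the ★ N1 data.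
[cite: Casselman1995, §6.4 Prop. 6.4.1 p. 61; Lemma 7.1.1 (a) p. 67] [cite: BernsteinZelevinsky1977, Thm. 2.9] [cite: Keys1984, §3, §7] [cite: Rogawski1990, §12.2 pp. 173–174] -/
theorem normalizedJacquet_cmPrincipalSeries_eq_smul_of_reducible
    (χ₁ : (LocalRing L v)ˣ →* ℂˣ) (χ₂ : ↥(normOneUnits (conjLocal L (IsCMField.complexConj L) v)) →* ℂˣ)
    (h1 : Continuous fun x => ((χ₁ x : ℂˣ) : ℂ)) (h2 : Continuous fun x => ((χ₂ x : ℂˣ) : ℂ)) (hχ₁u : ∀ x, ‖((χ₁ x : ℂˣ) : ℂ)‖ = 1)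
    (hred : ∃ N : Subrepresentation (cmPrincipalSeries L 3 v (cmTorusCharPair L v χ₁ χ₂)), N ≠ ⊥ ∧ N ≠ ⊤) :
    haveI := locallyCompactSpace_cmBorelU L 3 v
    ∀ (m : ↥(cmBorelTriple L 3 v).M) (x : ((cmBorelTriple L 3 v).restrict (cmPrincipalSeries L 3 v (cmTorusCharPair L v χ₁ χ₂))).Coinvariants),
      (cmPrincipalSeries L 3 v (cmTorusCharPair L v χ₁ χ₂)).normalizedJacquet (cmBorelTriple L 3 v) m x =
        ((cmTorusCharPair L v χ₁ χ₂ m : ℂˣ) : ℂ) • x := by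
  haveI := locallyCompactSpace_cmBorelU L 3 v
  -- (keep the goal `False` while the heavy `SmoothInd`-typed witnesses are introduced: with the `∀ m x` goal in place each `obtain` costs ≈ 4·10⁶ beats)
  by_contra hcon
  obtain ⟨N', hb, ht⟩ := hred
  -- complete reducibility and the second eigenfunctional (★ PS-UNITARY, ★ FILE 1 §3)
  have hss := F0P3cStCharTSPrincipalSeriesUnitary.isSemisimpleRepresentation_cmPrincipalSeries L 3 v (cmTorusCharPair L v χ₁ χ₂)
    (F0P3cStCharTSPSIrredRegular.norm_cmTorusCharPair_eq_one_of_norm_eq_one L v hns χ₁ χ₂ h2 hχ₁u)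
  obtain ⟨ℓ, hℓ, hind⟩ := F0P3cStCharTSRedOfEigenfunctional.exists_eigenfunctional_of_ne_bot_ne_top L 3 v (cmTorusCharPair L v χ₁ χ₂) hss N' hb ht
  -- `ev₁` as an eigenfunctional, non-zero
  obtain ⟨ev, hev⟩ : ∃ ev : Representation.SmoothInd (cmBorelTriple L 3 v).P
        (Representation.twist (((Representation.trivial ℂ ↥(torusU (conjLocal L (IsCMField.complexConj L) v) (cmLocalForm L 3 v)) ℂ).twist
          (cmTorusCharPair L v χ₁ χ₂)).comp (cmBorelTriple L 3 v).proj) (rootDeltaChar (cmBorelTriple L 3 v).P)) →ₗ[ℂ] ℂ, ∀ f, ev f = f.toFun 1 :=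
    ⟨{ toFun := fun f => f.toFun 1
       map_add' := fun f g => by rw [Representation.SmoothInd.toFun_add]; rfl
       map_smul' := fun c f => by rw [Representation.SmoothInd.toFun_smul]; rfl }, fun f => rfl⟩
  have hevB : ∀ (p : ↥(cmBorelTriple L 3 v).P) (f : _), ev (cmPrincipalSeries L 3 v (cmTorusCharPair L v χ₁ χ₂) p.1 f) =
      ((cmTorusCharPair L v χ₁ χ₂ ((cmBorelTriple L 3 v).proj p) : ℂˣ) : ℂ) * ((rootDeltaChar (cmBorelTriple L 3 v).P p : ℂˣ) : ℂ) * ev f := by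
    intro p f
    have e := F0P3cStCharTSRedOfEigenfunctional.toFun_one_apply_borel L 3 v (cmTorusCharPair L v χ₁ χ₂) p f
    simp only [hev]
    exact e
  have hev0 : ev ≠ 0 := by
    intro h0
    have htop : (⊤ : Subrepresentation (cmPrincipalSeries L 3 v (cmTorusCharPair L v χ₁ χ₂))) = ⊥ :=
      F0P3cStCharTSRedOfEigenfunctional.eq_bot_of_forall_toFun_one_eq_zero L 3 v (cmTorusCharPair L v χ₁ χ₂) ⊤ fun f _ => by
        rw [← hev f, h0, LinearMap.zero_apply]
    exact hb (le_bot_iff.1 (htop ▸ le_top))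
  have hind' : ∀ c : ℂ, ℓ ≠ c • ev := by
    intro c hc
    obtain ⟨f, hf⟩ := hind c
    exact hf (by rw [hc, LinearMap.smul_apply, hev, smul_eq_mul])
  -- the ★ N1 dimension datum and §1
  obtain ⟨hfin, hdim, -⟩ := F0P3cStCharTSJacLen1.n1_line_data L v hns χ₁ χ₂ h1 h2
  haveI := hfin
  exact hcon fun m x => normalizedJacquet_eq_smul_of_two_eigenfunctionals (cmBorelTriple L 3 v) (F0P2nBorelCharactersUnipotent.rootDeltaChar_cmBorel_eq_one L v)
    (cmPrincipalSeries L 3 v (cmTorusCharPair L v χ₁ χ₂)) (cmTorusCharPair L v χ₁ χ₂) hdim ev ℓ hevB hℓ hev0 hind' m x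

end CM

end Summit.HodgeConjecture.HodgeConjecture.R90.S1

end
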